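import Literature.AlgebraicGeometry.Motives.CoherentFracFamily
import Literature.AlgebraicGeometry.Motives.CartierDivisorSectionsOn
import HarnessLib

/-!
# `t ↦ Γ(U_t, 𝒪_Y(D))` is a coherent family on ANY cover with affine intersections (Görtz–Wedhorn I, Thm. 7.22 (2) and (11.9))

Let `Y` be an integral scheme, `D = (U_j, f_j)` a Cartier divisor on `Y` (`Motives/CartierDivisor`)
and `𝔘 = (U_t)_t` cover data on `Y` (`FracFamily.CoverData`, `Motives/CoherentFracFamily`: the
intersections of a finite cover by non-empty affine opens with affine intersections). The members
`U_t` are NOT assumed to lie inside charts `U_j` of `D` (contrast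
`CartierDivisor.CechCover.isCoherent_sectionsOn`, `Motives/CechComplexPseudoCoherentOfChow`, where the
Čech cover is adapted to `D` and `Γ(W_s, 𝒪(D)) = f_{c(a)}⁻¹ Γ(W_s, 𝒪)` is a one-liner). This file
PROVES that the family of sections `t ↦ Γ(U_t, 𝒪_Y(D)) ⊆ K(Y)` (`CartierDivisor.sectionsOn`,
`Motives/CartierDivisorSectionsOn`) is nevertheless a coherent family in the sense of
`FracFamily.IsCoherent` (`CartierDivisor.isCoherent_sectionsOn`, and `isCoherent_sectionsOn_coverData`
for scalars regular everywhere): monotone, a finitely generated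
`Γ(U_t, 𝒪_Y)`-module, with stalks `𝒪_{Y,y} · Γ(U_t, 𝒪_Y(D)) = f_j⁻¹ 𝒪_{Y,y}` independent of the
chart — i.e. `𝒪_Y(D)` is a coherent `𝒪_Y`-submodule of `𝒦_Y` (Görtz–Wedhorn I, (11.9): `𝒪_Y(D)` is
an invertible `𝒪_Y`-module), read on an arbitrary affine open.

The one honest input is **quasi-coherence of `𝒪_Y(D)` on an affine open `U` not inside a chart**
(`CartierDivisor.exists_pow_mul_isSectionOn_of_basicOpen`): a section `z` of `𝒪_Y(D)` over a
principal open `D_U(c)` becomes a section over `U` after multiplication by a power of `c`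
(`Γ(D_U(c), 𝒪_Y(D)) = Γ(U, 𝒪_Y(D))_c`, Görtz–Wedhorn I, Thm. 7.22 (2)). Proof: refine
`U = ⋃_j (U ∩ U_j)` by finitely many principal opens `D_U(k) ⊆ U_{j(k)}` with `(k) = (1)`
(`CartierDivisor.exists_finset_basicOpen_le_chart`); on `D_U(kc) ⊆ U_{j(k)}` the function
`f_{j(k)} z` is regular, so `(kc)^N f_{j(k)} z ∈ Γ(U, 𝒪_Y)` (`RatFn.exists_pow_mul_eq_ofSection`,
Thm. 7.22 (2) for `𝒪_Y`), whence `f_{j(k)} c^M z = c^{M-N} k^{-N} (kc)^N f_{j(k)} z` is regular on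
`D_U(k)` for `M ≥ N`; take the maximum over the finitely many `k`. Consequences: every affine `U`
carries sections `g = c^N f_j⁻¹ ∈ Γ(U, 𝒪_Y(D))` with `f_j g` a unit on a prescribed principal
neighbourhood `D_U(c) ⊆ U_j` (`exists_isSectionOn_forall_isUnitAt`), and such a `g` generates the
stalk: `z = (f_j z)(f_j g)⁻¹ · g ∈ 𝒪_{Y,y} · g` for every `z` with `f_j z` regular at `y`
(`mem_stalkSpan_of_isUnitAt`). Finite generation over `Γ(U_t, 𝒪_Y)` then follows from
`Γ(V) · S = ⋂_{y ∈ V} 𝒪_{Y,y} · S` (`FracFamily.mem_chartSpan_of_forall_mem_stalkSpan`,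
Görtz–Wedhorn I, Prop. 3.29 (3)), and chart-independence of the stalks is immediate.

Everything here is proved; no named facts, no definitions. Mathlib searched (pin):
`IsAffineOpen.exists_basicOpen_le`, `IsAffineOpen.iSup_basicOpen_eq_self_iff`,
`IsAffineOpen.self_le_iSup_basicOpen_iff`, `Submodule.mem_span_finite_of_mem_span`,
`Scheme.basicOpen_mul`, `Scheme.basicOpen_le`, `Opens.mem_iSup` (used); Mathlib has no `𝒪_X(D)`
and no (quasi-)coherent subsheaves of the sheaf of rational functions.

## References

* U. Görtz, T. Wedhorn, *Algebraic Geometry I: Schemes*, 2nd ed., Springer Spektrum (2020),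
  doi:10.1007/978-3-658-30733-2: §(2.2) Lemma 2.4 and Prop. 2.5 (principal opens: basis, and
  `(D(f_i))_i` covers `Spec A` iff `(f_i) = A`); Thm. 7.22 (2) (`Γ(X_s, 𝓕) = Γ(X, 𝓕)_s` for
  quasi-coherent `𝓕`); (7.9); Prop. 3.29 (3); Section (11.9), printed p. 301 ff. (`𝒪_X(D) ⊆ 𝒦_X`,
  `𝒪_X(D)|_{U_i} = f_i⁻¹ 𝒪_{U_i}`). [GortzWedhorn2020]
-/

universe u

open CategoryTheory AlgebraicGeometry TopologicalSpace Opposite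

noncomputable section

namespace Literature.AlgebraicGeometry.Motives

open RatFn FracFamily

namespace CartierDivisor

variable {Y : Scheme.{u}} [IsIntegral Y] (D : CartierDivisor Y)

/-! ### A finite principal refinement of an affine open by opens inside charts -/

/-- **A finite principal refinement inside charts with a partition of unity**: an affine open
`U = Spec R` of `Y` is covered by finitely many principal opens `D_U(k) ⊆ U_{j(k)}`, `k ∈ R`, lying
in charts of `D`, with `(k ; k) = (1)` (principal opens form a basis; they cover `U` iff they
generate the unit ideal, Mathlib `IsAffineOpen.self_le_iSup_basicOpen_iff`; the same argument as
`CartierDivisor.exists_basicOpen_le_span_eq_top` of `Motives/CartierDivisorCechAffine`, whose index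
universe is `Type`; Görtz–Wedhorn I, Lemma 2.4 with `g = 1` and Prop. 2.5).
[cite: GortzWedhorn2020, Lemma 2.4 and Prop. 2.5] -/
theorem exists_finset_basicOpen_le_chart {U : Y.Opens} (hU : IsAffineOpen U) :
    ∃ (t : Finset Γ(Y, U)) (i : t → D.ι), (∀ k : t, Y.basicOpen (k : Γ(Y, U)) ≤ D.U (i k)) ∧
      Ideal.span (t : Set Γ(Y, U)) = ⊤ := by
  classical
  have hx : ∀ x : U, ∃ (f : Γ(Y, U)) (j : D.ι), Y.basicOpen f ≤ D.U j ∧ (x : Y) ∈ Y.basicOpen f := by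
    intro x
    obtain ⟨j, hj⟩ := D.covers (x : Y)
    obtain ⟨f, hfW, hxf⟩ := hU.exists_basicOpen_le ⟨(x : Y), hj⟩ x.2
    exact ⟨f, j, hfW, hxf⟩
  choose f j hfj hxf using hx
  have hspan : Ideal.span (Set.range f) = ⊤ := by
    rw [← hU.self_le_iSup_basicOpen_iff]
    intro y hy
    exact Opens.mem_iSup.2 ⟨⟨f ⟨y, hy⟩, ⟨y, hy⟩, rfl⟩, hxf ⟨y, hy⟩⟩
  obtain ⟨t, ht, h1⟩ := Submodule.mem_span_finite_of_mem_span
    (show (1 : Γ(Y, U)) ∈ Ideal.span (Set.range f) from hspan ▸ Submodule.mem_top)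
  have hi : ∀ k : t, ∃ x : U, f x = k := fun k => ht k.2
  choose x hx' using hi
  refine ⟨t, fun k => j (x k), fun k => ?_, (Ideal.eq_top_iff_one _).2 h1⟩
  rw [← hx' k]
  exact hfj (x k)

/-! ### Quasi-coherence of `𝒪_Y(D)` on an affine open not inside a chart -/

/-- **`Γ(D_U(c), 𝒪_Y(D)) = Γ(U, 𝒪_Y(D))_c` (the extension half)**: for an affine open `U` of the
integral scheme `Y`, `c ∈ Γ(U, 𝒪_Y)` and a section `z ∈ Γ(D_U(c), 𝒪_Y(D))`, the rational function
`c^M z` is a section of `𝒪_Y(D)` over all of `U` for all large `M` (Görtz–Wedhorn I, Thm. 7.22 (2)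
for the quasi-coherent `𝒪_Y(D)`; here from Thm. 7.22 (2) for `𝒪_Y` on a finite refinement of
`U = ⋃_j (U ∩ U_j)` by principal opens inside charts). [cite: GortzWedhorn2020, Thm. 7.22 (2)] -/
theorem exists_pow_mul_isSectionOn_of_basicOpen {U : Y.Opens} (hU : IsAffineOpen U)
    (hξ : genericPoint Y ∈ U) (c : Γ(Y, U)) {z : Y.functionField}
    (hz : D.IsSectionOn (Y.basicOpen c : Set Y) z) :
    ∃ N : ℕ, ∀ M, N ≤ M → D.IsSectionOn (U : Set Y) (ofSection hξ c ^ M * z) := by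
  classical
  -- a finite refinement of `U = ⋃_j (U ∩ U_j)` by principal opens `D_U(k) ⊆ U_{j(k)}`, `(k) = (1)`
  obtain ⟨t, i, hti, hspan⟩ := D.exists_finset_basicOpen_le_chart hU
  by_cases hc : ofSection hξ c = 0
  · refine ⟨1, fun M hM => ?_⟩
    rw [hc, zero_pow (by omega), zero_mul]
    exact isSectionOn_zero U
  -- on each `D_U(k)` the bound given by `Γ(D_U(kc), 𝒪_Y) = Γ(U, 𝒪_Y)_{kc}` applied to `f_{j(k)} z`
  have hk : ∀ k : t, ∃ N : ℕ, ∀ M, N ≤ M → ∀ y ∈ Y.basicOpen (k : Γ(Y, U)),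
      IsRegularAt y (D.f (i k) * (ofSection hξ c ^ M * z)) := by
    intro k
    by_cases hkc : genericPoint Y ∈ Y.basicOpen ((k : Γ(Y, U)) * c)
    · have hβ : ∀ y ∈ Y.basicOpen ((k : Γ(Y, U)) * c), IsRegularAt y (D.f (i k) * z) := by
        intro y hy
        rw [Scheme.basicOpen_mul] at hy
        exact hz (i k) y (hti k hy.1) hy.2
      obtain ⟨N, a, e⟩ := exists_pow_mul_eq_ofSection hU _ hkc hβ
      have e' : ofSection hξ ((k : Γ(Y, U)) * c) ^ N * (D.f (i k) * z) = ofSection hξ a := e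
      refine ⟨N, fun M hM y hy => ?_⟩
      obtain ⟨m, rfl⟩ := Nat.exists_eq_add_of_le hM
      have hyU : y ∈ U := Y.basicOpen_le _ hy
      have hku : IsUnitAt y (ofSection hξ (k : Γ(Y, U))) := (isUnitAt_ofSection_iff hyU _).2 hy
      have hk0 : ofSection hξ (k : Γ(Y, U)) ≠ 0 := hku.ne_zero
      have hmul : ofSection hξ ((k : Γ(Y, U)) * c) = ofSection hξ (k : Γ(Y, U)) * ofSection hξ c := by
        simp only [map_mul]
      have eq : D.f (i k) * (ofSection hξ c ^ (N + m) * z) =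
          ofSection hξ c ^ m * (ofSection hξ (k : Γ(Y, U)) ^ N)⁻¹ *
            (ofSection hξ ((k : Γ(Y, U)) * c) ^ N * (D.f (i k) * z)) := by
        rw [hmul, mul_pow, pow_add]
        field_simp
      rw [eq, e']
      exact (((isRegularAt_ofSection hyU c).pow m).mul (hku.pow N).inv.isRegularAt).mul
        (isRegularAt_ofSection hyU a)
    · -- `kc = 0` in `K(Y)` with `c ≠ 0`: `k = 0` and `D_U(k)` is empty
      refine ⟨0, fun M _ y hy => ?_⟩
      exfalso
      have hyU : y ∈ U := Y.basicOpen_le _ hy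
      have hku : IsUnitAt y (ofSection hξ (k : Γ(Y, U))) := (isUnitAt_ofSection_iff hyU _).2 hy
      apply hkc
      rw [genericPoint_mem_basicOpen_iff hξ,
        show ofSection hξ ((k : Γ(Y, U)) * c) = ofSection hξ (k : Γ(Y, U)) * ofSection hξ c by
          simp only [map_mul]]
      exact mul_ne_zero hku.ne_zero hc
  choose N hN using hk
  refine ⟨Finset.univ.sup N, fun M hM j y hj hyU => ?_⟩
  -- `y` lies in some `D_U(k)`, `k ∈ t`, since `(k ; k ∈ t) = (1)`
  have hy : y ∈ ⨆ k : (t : Set Γ(Y, U)), Y.basicOpen (k : Γ(Y, U)) := by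
    rw [hU.iSup_basicOpen_eq_self_iff.2 hspan]
    exact hyU
  obtain ⟨k, hk⟩ := Opens.mem_iSup.1 hy
  have h1 := hN ⟨(k : Γ(Y, U)), k.2⟩ M ((Finset.le_sup (Finset.mem_univ _)).trans hM) y hk
  have e : D.f j * (ofSection hξ c ^ M * z) =
      D.f j / D.f (i ⟨(k : Γ(Y, U)), k.2⟩) *
        (D.f (i ⟨(k : Γ(Y, U)), k.2⟩) * (ofSection hξ c ^ M * z)) :=
    (by rw [← mul_assoc, div_mul_cancel₀ _ (D.f_ne_zero _)] :
      D.f j / D.f (i ⟨(k : Γ(Y, U)), k.2⟩) *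
        (D.f (i ⟨(k : Γ(Y, U)), k.2⟩) * (ofSection hξ c ^ M * z)) = _).symm
  rw [e]
  exact (D.isUnitAt_div j _ y hj (hti _ hk)).isRegularAt.mul h1

/-- The same, for the submodules `Γ(U, 𝒪_Y(D)) ⊆ K(Y)` over a base ring `A` acting by functions
regular on `U`: `c^M z ∈ Γ(U, 𝒪_Y(D))` for `M ≫ 0` when `z ∈ Γ(D_U(c), 𝒪_Y(D))`
(Görtz–Wedhorn I, Thm. 7.22 (2)). [cite: GortzWedhorn2020, Thm. 7.22 (2)] -/
theorem exists_pow_mul_mem_sectionsOn_of_basicOpen {A : Type u} [CommRing A]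
    [Algebra A Y.functionField] {U : Y.Opens} (hU : IsAffineOpen U) (hξ : genericPoint Y ∈ U)
    (hρ : ∀ a, ∀ x ∈ U, IsRegularAt x (algebraMap A Y.functionField a)) (c : Γ(Y, U))
    {z : Y.functionField} (hz : D.IsSectionOn (Y.basicOpen c : Set Y) z) :
    ∃ N : ℕ, ∀ M, N ≤ M → ofSection hξ c ^ M * z ∈ D.sectionsOn U hρ :=
  D.exists_pow_mul_isSectionOn_of_basicOpen hU hξ c hz

/-! ### Local generators of `𝒪_Y(D)` over an affine open -/

/-- **Local generators over an affine open**: for `U` affine and a principal open `D_U(c)` inside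
a chart `U_j`, there is a section `g ∈ Γ(U, 𝒪_Y(D))` (namely `g = c^N f_j⁻¹`) with `f_j g` a unit
at every point of `D_U(c)` — `g` generates `𝒪_Y(D) = f_j⁻¹ 𝒪_Y` on `D_U(c)`
(Görtz–Wedhorn I, (11.9) with Thm. 7.22 (2)). [cite: GortzWedhorn2020, Section (11.9) (p. 301)] -/
theorem exists_isSectionOn_forall_isUnitAt {U : Y.Opens} (hU : IsAffineOpen U)
    (hξ : genericPoint Y ∈ U) (c : Γ(Y, U)) {j : D.ι} (hc : Y.basicOpen c ≤ D.U j) :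
    ∃ g : Y.functionField, D.IsSectionOn (U : Set Y) g ∧
      ∀ y ∈ Y.basicOpen c, IsUnitAt y (D.f j * g) := by
  -- `f_j⁻¹ ∈ Γ(D_U(c), 𝒪_Y(D))`
  have hz : D.IsSectionOn (Y.basicOpen c : Set Y) (D.f j)⁻¹ := by
    rw [isSectionOn_iff_of_le hc]
    intro x _
    rw [mul_inv_cancel₀ (D.f_ne_zero j)]
    exact isRegularAt_one
  obtain ⟨N, hN⟩ := D.exists_pow_mul_isSectionOn_of_basicOpen hU hξ c hz
  refine ⟨ofSection hξ c ^ N * (D.f j)⁻¹, hN N le_rfl, fun y hy => ?_⟩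
  rw [mul_left_comm, mul_inv_cancel₀ (D.f_ne_zero j), mul_one]
  exact ((isUnitAt_ofSection_iff (Y.basicOpen_le c hy) c).2 hy).pow N

/-- **Every point of an affine open has such a generator**: for `U` affine and `y ∈ U ∩ U_j` there
is `g ∈ Γ(U, 𝒪_Y(D))` with `f_j g` a unit at `y` (`𝒪_Y(D)_y = f_j⁻¹ 𝒪_{Y,y}` is generated by a
section over `U`; Görtz–Wedhorn I, (7.9)/(11.9)). [cite: GortzWedhorn2020, Section (11.9) (p. 301)] -/
theorem exists_isSectionOn_isUnitAt {U : Y.Opens} (hU : IsAffineOpen U) {y : Y} (hy : y ∈ U)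
    {j : D.ι} (hj : y ∈ D.U j) :
    ∃ g : Y.functionField, D.IsSectionOn (U : Set Y) g ∧ IsUnitAt y (D.f j * g) := by
  obtain ⟨c, hcU, hyc⟩ := hU.exists_basicOpen_le ⟨y, hj⟩ hy
  obtain ⟨g, hg, hgu⟩ :=
    D.exists_isSectionOn_forall_isUnitAt hU (genericPoint_mem_of_mem hy) c hcU
  exact ⟨g, hg, hgu y hyc⟩

/-- **A local generator generates the stalk**: if `f_j g` is a unit at `y` and `f_j z` is regular
at `y` (`z ∈ 𝒪_Y(D)_y = f_j⁻¹ 𝒪_{Y,y}`), then `z = (f_j z)(f_j g)⁻¹ · g ∈ 𝒪_{Y,y} · S` for every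
`S ∋ g` (`FracFamily.stalkSpan`; `𝒪_Y(D)_y = f_j⁻¹ 𝒪_{Y,y}`, Görtz–Wedhorn I, (11.9)).
[cite: GortzWedhorn2020, Section (11.9) (p. 301)] -/
theorem mem_stalkSpan_of_isUnitAt {A : Type u} [CommRing A] [Algebra A Y.functionField] {y : Y}
    {j : D.ι} {g z : Y.functionField} (hg : IsUnitAt y (D.f j * g))
    (hz : IsRegularAt y (D.f j * z)) {S : Set Y.functionField} (hgS : g ∈ S) :
    z ∈ stalkSpan (A := A) y S := by
  have hg0 : g ≠ 0 := fun h => hg.ne_zero (by rw [h, mul_zero])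
  refine Submodule.subset_span ⟨D.f j * z * (D.f j * g)⁻¹, g, hz.mul hg.inv.isRegularAt, hgS, ?_⟩
  field_simp [D.f_ne_zero j]

/-! ### The coherent family `t ↦ Γ(U_t, 𝒪_Y(D))` -/

/-- **`t ↦ Γ(U_t, 𝒪_Y(D)) ⊆ K(Y)` is a coherent family on any cover data `𝔘`** (members affine,
NOT necessarily inside charts of `D`), for every base ring `A` acting on `K(Y)` by functions
regular on the `U_t` (`hρ`): restriction is inclusion; `Γ(U_t, 𝒪_Y(D))` is a `Γ(U_t, 𝒪_Y)`-module,
finitely generated — by the local generators `c_k^{N_k} f_{j(k)}⁻¹` of a finite principal refinement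
of `U_t = ⋃_j (U_t ∩ U_j)`, through `Γ(V) · S = ⋂_{y ∈ V} 𝒪_{Y,y} · S`; and its stalks
`𝒪_{Y,y} · Γ(U_t, 𝒪_Y(D)) = f_j⁻¹ 𝒪_{Y,y}` (`y ∈ U_t ∩ U_j`) do not depend on `t`
(Görtz–Wedhorn I, (11.9): `𝒪_Y(D)` is an invertible, in particular coherent, `𝒪_Y`-submodule of
`𝒦_Y`; (7.9) and Thm. 7.22 (2) for its sections on affine opens).
[cite: GortzWedhorn2020, Section (11.9) (p. 301)] -/
theorem isCoherent_sectionsOn {A : Type u} [CommRing A] [Algebra A Y.functionField] {ι : Type}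
    (𝔘 : CoverData Y ι)
    (hρ : ∀ t a, ∀ x ∈ 𝔘.U t, IsRegularAt x (algebraMap A Y.functionField a)) :
    IsCoherent 𝔘 fun t => D.sectionsOn (𝔘.U t) (hρ t) := by
  classical
  refine ⟨fun s t hst => sectionsOn_mono (𝔘.anti hst) _ _, ?_, ?_, ?_⟩
  · intro t _ b x hx
    exact hx.mul_left fun y hy => isRegularAt_algebraMap_sections (V := 𝔘.U t) ⟨y, hy⟩ b
  · -- finite generation over `Γ(U_t, 𝒪_Y)`
    intro t ht
    have hU : IsAffineOpen (𝔘.U t) := 𝔘.affine ht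
    have hξ : genericPoint Y ∈ 𝔘.U t := 𝔘.genericPoint_mem t
    obtain ⟨w, i, hwi, hspan⟩ := D.exists_finset_basicOpen_le_chart hU
    have hgen : ∀ k : w, ∃ g : Y.functionField, D.IsSectionOn (𝔘.U t : Set Y) g ∧
        ∀ y ∈ Y.basicOpen (k : Γ(Y, 𝔘.U t)), IsUnitAt y (D.f (i k) * g) :=
      fun k => D.exists_isSectionOn_forall_isUnitAt hU hξ (k : Γ(Y, 𝔘.U t)) (hwi k)
    choose g hg hgu using hgen
    refine ⟨Finset.univ.image g, ?_, ?_⟩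
    · intro x hx
      rw [Finset.coe_image] at hx
      obtain ⟨k, _, rfl⟩ := hx
      exact hg k
    · intro z hz
      refine mem_chartSpan_of_forall_mem_stalkSpan hU fun y => ?_
      have hy : (y : Y) ∈ ⨆ k : (w : Set Γ(Y, 𝔘.U t)), Y.basicOpen (k : Γ(Y, 𝔘.U t)) := by
        rw [hU.iSup_basicOpen_eq_self_iff.2 hspan]
        exact y.2
      obtain ⟨k, hk⟩ := Opens.mem_iSup.1 hy
      have hz' : D.IsSectionOn (𝔘.U t : Set Y) z := hz
      refine D.mem_stalkSpan_of_isUnitAt (hgu ⟨(k : Γ(Y, 𝔘.U t)), k.2⟩ y hk)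
        (hz' (i ⟨(k : Γ(Y, 𝔘.U t)), k.2⟩) y (hwi _ hk) y.2) ?_
      rw [Finset.coe_image]
      exact ⟨_, Finset.mem_coe.2 (Finset.mem_univ _), rfl⟩
  · -- the stalks do not depend on the chart
    intro s t hs hst y hyt
    have hUs : IsAffineOpen (𝔘.U s) := 𝔘.affine hs
    have hys : y ∈ 𝔘.U s := 𝔘.anti hst hyt
    obtain ⟨j, hj⟩ := D.covers y
    obtain ⟨g, hg, hgu⟩ := D.exists_isSectionOn_isUnitAt hUs hys hj
    refine stalkSpan_le (fun z hz => ?_) fun f z hf hz => isRegularAt_mul_mem_stalkSpan hf hz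
    have hz' : D.IsSectionOn (𝔘.U t : Set Y) z := hz
    exact D.mem_stalkSpan_of_isUnitAt hgu (hz' j y hj hyt) hg

/-- The same with a base ring acting by functions regular EVERYWHERE on `Y` (e.g. constants of a
ground field, or `Γ(T, 𝒪_T)` for `Y → T`): `t ↦ Γ(U_t, 𝒪_Y(D))` is a coherent family on every
cover data. [cite: GortzWedhorn2020, Section (11.9) (p. 301)] -/
theorem isCoherent_sectionsOn_coverData {A : Type u} [CommRing A] [Algebra A Y.functionField]
    (hρ : ∀ a (y : Y), IsRegularAt y (algebraMap A Y.functionField a)) {ι : Type}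
    (𝔘 : CoverData Y ι) :
    IsCoherent 𝔘 fun t => D.sectionsOn (𝔘.U t) fun a y _ => hρ a y :=
  D.isCoherent_sectionsOn 𝔘 fun _ a y _ => hρ a y

/-- **`Γ(U_t, 𝒪_Y(D)) ≠ 0`**: the family is non-zero on every member `U_t`, `t ≠ ∅` (it contains a
local generator at the generic point; `𝒪_Y(D)` is invertible, Görtz–Wedhorn I, (11.9)).
[cite: GortzWedhorn2020, Section (11.9) (p. 301)] -/
theorem sectionsOn_coverData_ne_bot {A : Type u} [CommRing A] [Algebra A Y.functionField]
    {ι : Type} (𝔘 : CoverData Y ι)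
    (hρ : ∀ t a, ∀ x ∈ 𝔘.U t, IsRegularAt x (algebraMap A Y.functionField a)) {t : Finset ι}
    (ht : t.Nonempty) : D.sectionsOn (𝔘.U t) (hρ t) ≠ ⊥ := by
  obtain ⟨j, hj⟩ := D.covers (genericPoint Y)
  obtain ⟨g, hg, hgu⟩ := D.exists_isSectionOn_isUnitAt (𝔘.affine ht) (𝔘.genericPoint_mem t) hj
  intro h
  have hg' : g ∈ D.sectionsOn (𝔘.U t) (hρ t) := hg
  rw [h, Submodule.mem_bot] at hg'
  exact hgu.ne_zero (by rw [hg', mul_zero])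

end CartierDivisor

end Literature.AlgebraicGeometry.Motives

end
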